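/-
Copyright (c) 2026 the pub-hodgecm-mathlib formalisation cell (harness21).  Prover seat hodgecm-mathlib-LH7-p08 (g0) (re-dealt to strike line L3 `stub_N6nsDyadic` by director
s1969 (a)), Track A «(D-RAM) FOUR-FRAME» squad, helper lane on h413 = stmt-HodgeConjecture-24833 (count-neutral).  β-BOARD v1 row R8 ∕ (P5) «H `(2ρ,2ρ,2ρ)`», FILE 3e: the
per-lattice labelled-odd value on the core-hanging stratum for a DEEP key `(L, m, m)` (special tower 1, own slot 0) — the two-slot label COLLAPSES to slot 0.  2026-09-04.
-/
import Summits.HodgeConjecture.HodgeConjecture.Theorems.F0P3cDyRamTwoSlotLabelReadCoreHanging         -- ★ p861388 (this seat, FILE 2a): `valueClassLabel_latt_coreHanging_iff_normSign_linear`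
import Summits.HodgeConjecture.HodgeConjecture.Theorems.F0P3cDyRamLabelledOddCoreHangingDeepRead      -- ★ p861532 (this seat, FILE 3a): the key-(m,m,L) twin (for reference; nothing used)
import Summits.HodgeConjecture.HodgeConjecture.Theorems.F0P3cDyRamLabelledOddOneSlotRead               -- ★ p860757-line (F0P3-p01 (g36)): `labelledOddCount_div_relIndex_eq_of_oneSlot`
import Summits.HodgeConjecture.HodgeConjecture.Theorems.F0P3cDyRamDiagonalKappaCoreHangingClass         -- ★ κH-A2 (LH4-p06 (g3)): `chiVec_eq_one_of_mem_fixedUnitStabilizer_of_le`, `exists_mem_fixedUnitStabilizer_chiVec_ne_one_of_lt`; brings ★ κH (A1)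
import Summits.HodgeConjecture.HodgeConjecture.Theorems.F0P3cDyRamDiagonalOrbitFibreTransport           -- ★ (F0P3-p01): `fibre_isCoset_zero`
import Summits.HodgeConjecture.HodgeConjecture.Theorems.F0P3cDyRamDiagonalOrbitFibreCountHeads          -- ★: `finite_unitTorus_orbit_of_mem_normalisedStableLattices`
import Summits.HodgeConjecture.HodgeConjecture.Theorems.F0P3cDyRamStableCountTypeZero                    -- ★ (LH4-p12): `v_diag_eq_one`, `diag_regular`
import Literature.NumberTheory.LocalFields.WildQuadraticDatumNormSignConductor                          -- ★ toolkit: `normSign_eq_of_near`, `normSign_mul_of_fixed`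
import Literature.NumberTheory.LocalFields.WildQuadraticDatumNonNormUnit                                -- ★ `exists_nonnorm_dichotomy_of_isRamifiedQuadraticDatum` (unit non-norm + full dichotomy)
import Literature.NumberTheory.LocalFields.ValuedCompleteIsAdicComplete                                 -- ★ `isAdicComplete_valuedInteger_of_completeSpace`
import HarnessLib

/-!
# Crux `H413`, line LH4 «(D-RAM) FOUR-FRAME» — (β) table, β-BOARD row R8 ∕ (P5), FILE 3e: «THE DEEP KEY `(L, m, m)`: ON THE CORE-HANGING STRATUM THE (β) LABEL IS ONE-SLOT IN
# SLOT 0, AND THE LABELLED-ODD VALUE OF EVERY MEMBER IS `w(M)∕2 · (ω(f)·ε, ε·ι, ω(−(1+f))·ε·ι)`, `ε = ω(f)ω(g_α)`, `ι = [2d−1 ≤ ρ]`» (the slot-0 twin of ★ p861532)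

Cell `hodgecm-mathlib` (D-0151), FLOOR 0, crux item H413 = `stmt-HodgeConjecture-24833`, route `HCCMUnconditional`; squad F0∕P3c∕LH4.  THEOREMS ONLY (no `def`, no instance, no
notation, no `sorry`, default heartbeats); ★-only imports; lane `--supports stmt-HodgeConjecture-24833 --as helper` (count-neutral); pays NO row, states NO law.

THE MATHEMATICS (this seat's H-ROW DERIVATION v1 e4da7f0103cc4a29 §3, key `(m,m,L)`, deep range; and its addendum 386f7598 §A: the per-lattice constant).  Let
`M = latt(1 0 0; x ϖ^ρ 0; xζ+f·xζ ϖ^ρζ ϖ^{2ρ})` be any member of the core-hanging orbit of `V_H(1,1,f)` (`x, ζ` units, `f` a σ-FIXED unit, `|1+f| = 1`, `ρ ≥ 1`, `2d−1 ≤ 2ρ`), on the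
clean shell and `T`-stable, with its ★ κH (A1) polarisation `D` (`D₁ = π₀^{−ρ}`, `D₀ = D₁·N(x)·f`, `D₂ = −D₁∕(Nζ(1+f))`; `(ω(D₀),ω(D₁),ω(D₂)) = (ω(f), 1, ω(−(1+f)))`).  By ★ p861388
(FILE 2a) the (β) label of the class `D·u`, `u ∈ S_F(M)`, is `ω(u₀D₀g_α + u₁D₁N(x)g_β) = ω(u₀·f·g_α + u₁·g_β)` for fixed approximants `g_α, g_β` of `(α−1)∕t₊`, `(β−1)∕t₊` to precision
`ϖ^{m*}` after the weight `π₀^{−ρ}`.  DEEP KEY `(L,m,m)` (`n₂ = n₃ = m`, `n₁ = L ≥ m + 2d`): the `β − 1` tower is deep, `|g_β| ≤ |ϖ|^{2d−1}·|g_α|`, so the `u₁·g_β` term is below the conductor precision of `ω` (★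
`normSign_eq_of_near`) relative to `u₀·f·g_α`: `ω(u₀·f·g_α + u₁·g_β) = ω(f)·ω(g_α)·ω(u₀)` — the label is ONE-SLOT in slot `k = 0` with sign `ε = ω(f)ω(g_α)` (§1; no `S_F` letter needed).  Hence F0P3-p01's ★ ONE-SLOT head
`labelledOddCount_div_relIndex_eq_of_oneSlot` applies: `m^Λ_i(M)∕[𝒰 : N′] = ε·ω(D_i)∕2·[ω(u_i)ω(u₂) ≡ 1 on S_F]·w(M)`, and the indicator is ★ κH-A2's alive∕dead window
(`1` at `i = 0`; `[2d−1 ≤ ρ]` at `i = 1, 2`) (§2 HEAD).  No transversal, no product system, no character sum enters the per-lattice value; FILE 3b sums it over the stratum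
(special slot 0: the CONSTANT `ω(g_α)·w∕2` ⇒ `ω(e_A)∕2·(q−2)q^{2ρ−1}`; slots 1, 2: `ι·Σ_{g adm} χ^H(g) = 0` by ★ κH-B1).
HONEST LABEL.  Count-neutral (`--supports`); the stratum sum (FILE 3b), the boundary key, the boundary key `s_g = 2d−2` (genuinely two-slot), the
R8 value, `hRest`, (T3), (β-BAL), (β), T₊ stay OPEN; `HC_CM` is proved only modulo the 7 printed citations (2 remaining named inputs: hLiu418 = `stmt-HodgeConjecture-24832`, h413 =
`stmt-HodgeConjecture-24833`) until rung 0 closes.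

## References
* [Kottwitz1986BaseChangeUnits] R. E. Kottwitz, *Base change for unit elements of Hecke algebras*, Compositio Math. 60 (1986), §1 pp. 240–241 (signed lattice counts modulo the torus).
* [LanglandsShelstad1987] R. P. Langlands, D. Shelstad, *On the definition of transfer factors*, Math. Ann. 278 (1987), §3.
* [Rogawski1990] J. D. Rogawski, *Automorphic Representations of Unitary Groups in Three Variables*, Ann. of Math. Stud. 123 (1990), §4.9 Prop. 4.9.1 (a)(b) p. 55, §4.10 p. 58.
* [Serre1979] J.-P. Serre, *Local Fields*, GTM 67 (1979), Ch. V §3 Cor. 3, Ch. XV §2 (the conductor of the quadratic character).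
-/

set_option autoImplicit false

noncomputable section

namespace Summit.HodgeConjecture.HodgeConjecture.Cruxes.H413.F0P3cDyRamLabelledOddCoreHangingDeepReadOne

open Matrix WithZero
open Literature.NumberTheory.Automorphic Literature.NumberTheory.Automorphic.HermitianLattice Literature.NumberTheory.Automorphic.UnitaryGroup
open Literature.NumberTheory.Automorphic.UnitaryLatticeTree Literature.NumberTheory.Automorphic.UnitaryThreeFourFrame
open Literature.NumberTheory.LocalFields Literature.NumberTheory.LocalFields.WildQuadraticDatum
open Summit.HodgeConjecture.HodgeConjecture.Cruxes.H413.F0P3cDyRamFourFramePieces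
open Summit.HodgeConjecture.HodgeConjecture.Cruxes.H413.F0P3cDyRamFourFrameCensusDefs
open Summit.HodgeConjecture.HodgeConjecture.Cruxes.H413.F0P3cDyRamDiagonalTorusDefs
open Summit.HodgeConjecture.HodgeConjecture.Cruxes.H413.F0P3cDyRamLabelledOddCountDefs
open Summit.HodgeConjecture.HodgeConjecture.Cruxes.H413.F0P3cDyRamTwoSlotLabelReadCoreHanging (valueClassLabel_latt_coreHanging_iff_normSign_linear)
open Summit.HodgeConjecture.HodgeConjecture.Cruxes.H413.F0P3cDyRamLabelledOddOneSlotRead (labelledOddCount_div_relIndex_eq_of_oneSlot)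
open Summit.HodgeConjecture.HodgeConjecture.Cruxes.H413.F0P3cDyRamDiagonalKappaCoreHangingClass
open Summit.HodgeConjecture.HodgeConjecture.Cruxes.H413.F0P3cDyRamDiagonalCoreHangingPolarisationExplicit
open Summit.HodgeConjecture.HodgeConjecture.Cruxes.H413.F0P3cDyRamDiagonalGluedFixedStabiliser (mem_fixedUnitStabilizer_latt_glued_iff)
open Summit.HodgeConjecture.HodgeConjecture.Cruxes.H413.F0P3cDyRamDiagonalOrbitFibreTransport (fibre_isCoset_zero)
open Summit.HodgeConjecture.HodgeConjecture.Cruxes.H413.F0P3cDyRamDiagonalOrbitFibreCountHeads (finite_unitTorus_orbit_of_mem_normalisedStableLattices)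
open Summit.HodgeConjecture.HodgeConjecture.Cruxes.H413.F0P3cDyRamDiagonalCoreHangingCount (isNormalisedLattice_latt_coreHanging)
open Summit.HodgeConjecture.HodgeConjecture.Cruxes.H413.F0P3cDyRamStableCountTypeZero (v_diag_eq_one diag_regular)
open Summit.HodgeConjecture.HodgeConjecture.Cruxes.H413.F0P3cDyRamDiagonalKappaSplitCountEval (normSign_mul_self)
open scoped Valued WithZero Matrix MatrixGroups

variable {K : Type} [Field K] [Valued K ℤᵐ⁰]

/-! ## §1  The deep collapse, key `(L, m, m)`: `ω(u₀·f·g_α + u₁·g_β) = ω(f)·ω(g_α)·ω(u₀)` -/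

/-- **DEEP COLLAPSE, KEY `(L, m, m)`.**  Ramified datum on a complete field with finite residue field; `f` a fixed unit, `g_α ≠ 0`, `g_β` fixed, `|g_β| ≤ |ϖ|^{2d−1}·|g_α|`; `u` fixed units
(`u ∈ S_F(M)` of any lattice `M`).  Then `normSign σ (u₀·f·g_α + u₁·g_β) = normSign σ f · normSign σ g_α · normSign σ u₀` (`u₀fg_α + u₁g_β = g_α·(u₀f + u₁g_β∕g_α)`, the second summand
`𝔭^{2d−1}`-small against the unit `u₀f`: ★ `normSign_eq_of_near`, ★ `normSign_mul_of_fixed`). [cite: Serre1979, Ch. XV §2] [cite: Kottwitz1986BaseChangeUnits, §1 pp. 240–241] -/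
theorem normSign_twoSlot_eq_of_deep₁ [CompleteSpace K] [Finite 𝓀[K]] {σ : K →+* K} {ϖ : K} {d t : ℕ} (hD : IsRamifiedQuadraticDatum σ ϖ d t)
    {f : K} (hσf : σ f = f) (hf : Valued.v f = 1)
    {gα gβ : K} (hσgα : σ gα = gα) (hσgβ : σ gβ = gβ) (hgα0 : gα ≠ 0) (hsmall : Valued.v gβ ≤ Valued.v ϖ ^ (2 * d - 1) * Valued.v gα)
    {M : Submodule 𝒪[K] (Fin 3 → K)} {u : Fin 3 → Kˣ} (hu : u ∈ fixedUnitStabilizer σ M) :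
    normSign σ (((u 0 : Kˣ) : K) * f * gα + ((u 1 : Kˣ) : K) * gβ) = normSign σ f * normSign σ gα * normSign σ ((u 0 : Kˣ) : K) := by
  obtain ⟨hσ, hvσ, hϖ, hfix, hdd, hd1, -⟩ := id hD
  have hf0 : f ≠ 0 := fun h => by rw [h, map_zero] at hf; exact zero_ne_one hf
  have huT : u ∈ fixedUnitTorus σ 3 := hu.2
  have hufix : ∀ j, σ ((u j : Kˣ) : K) = u j := fun j => ((mem_fixedUnitTorus_iff σ u).1 huT).2 j
  have huv : ∀ j, Valued.v ((u j : Kˣ) : K) = 1 := fun j => ((mem_fixedUnitTorus_iff σ u).1 huT).1 j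
  set W : K := ((u 0 : Kˣ) : K) * f + ((u 1 : Kˣ) : K) * (gβ * gα⁻¹) with hW
  have hfac : ((u 0 : Kˣ) : K) * f * gα + ((u 1 : Kˣ) : K) * gβ = gα * W := by rw [hW]; field_simp
  have hσW : σ W = W := by rw [hW]; simp only [map_add, map_mul, map_inv₀, hσf, hufix, hσgα, hσgβ]
  have hW'1 : Valued.v (((u 0 : Kˣ) : K) * f) = 1 := by rw [map_mul, huv 0, hf, one_mul]
  have hσW' : σ (((u 0 : Kˣ) : K) * f) = ((u 0 : Kˣ) : K) * f := by rw [map_mul, hufix 0, hσf]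
  have hdiff : Valued.v (((u 0 : Kˣ) : K) * f - W) ≤ Valued.v ϖ ^ (2 * d - 1) := by
    have e : ((u 0 : Kˣ) : K) * f - W = -(((u 1 : Kˣ) : K) * (gβ * gα⁻¹)) := by rw [hW]; ring
    have hvgα : 0 < Valued.v gα := (Valuation.pos_iff _).2 hgα0
    rw [e, Valuation.map_neg, map_mul, huv 1, one_mul, map_mul, map_inv₀, mul_inv_le_iff₀ hvgα]
    exact hsmall
  have hωW : normSign σ W = normSign σ (((u 0 : Kˣ) : K) * f) := normSign_eq_of_near hD hσW' hσW hW'1 le_rfl hdiff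
  have hW0 : W ≠ 0 := by
    intro h0
    have : Valued.v (((u 0 : Kˣ) : K) * f) ≤ Valued.v ϖ ^ (2 * d - 1) := by
      have e : ((u 0 : Kˣ) : K) * f = ((u 0 : Kˣ) : K) * f - W := by rw [h0, sub_zero]
      rw [e]; exact hdiff
    rw [hW'1] at this
    have hlt : Valued.v ϖ ^ (2 * d - 1) < 1 := pow_lt_one₀ zero_le (by rw [hϖ, ← exp_zero, exp_lt_exp]; norm_num) (by omega)
    exact absurd this (not_le.2 hlt)
  rw [hfac, normSign_mul_of_fixed hD hσgα hσW hgα0 hW0, hωW, normSign_mul_of_fixed hD (hufix 0) hσf (u 0).ne_zero hf0]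
  ring

/-! ## §2  HEAD — the per-lattice labelled-odd value on the core-hanging stratum, deep key `(L, m, m)` -/

/-- **THE LABELLED-ODD VALUE OF A CORE-HANGING LATTICE, DEEP KEY `(L, m, m)`.**  Ramified datum (`|2| < 1`, complete, finite residue field), `ρ ≥ 1`, `2d − 1 ≤ 2ρ`; a member
`M = latt(1 0 0; x ϖ^ρ 0; xζ+f·xζ ϖ^ρζ ϖ^{2ρ})` of the core-hanging stratum (`x, ζ` units, `f` a fixed unit with `|1+f| = 1`) which is `T`-stable and normalised-stable
(`M ∈ 𝓛₀(T)`, `T = diag(α, β, 1)`, element datum `hE`), on the clean shell (the three tokens; on `H(ρ)` they read `2ρ + ℓ₀ = min(n₁,n₂)` — ★ p861362); fixed approximants `g_α ≠ 0`, `g_β`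
with `|ϖ^{−m*}·π₀^{−ρ}·((α−1) − g_α t₊)| ≤ 1`, `|ϖ^{−m*}·π₀^{−ρ}·((β−1) − g_β t₊)| ≤ 1` and the DEEP letter `|g_β| ≤ |ϖ|^{2d−1}·|g_α|`.  Then, slot by slot,
`labelledOddCount σ ϖ 0 i Λ M ∕ [𝒰 : N(S̃(M))] = stabiliserWeight σ M ∕ 2 · (ω(f)·ε, ε·ι, ω(−(1+f))·ε·ι)_i`, `ε = ω(f)ω(g_α)`, `ι = [2d−1 ≤ ρ]`, `Λ = valueClassLabel σ ϖ (α−1) (β−1) m* d`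
— F0P3-p01's ★ ONE-SLOT head at `k = 0` (§1 collapse), `ω(D) = (ω(f), 1, ω(−(1+f)))` (★ κH (A1)), the pair indicators by ★ κH-A2's alive ∕ dead window. [cite: Kottwitz1986BaseChangeUnits, §1 pp. 240–241] [cite: LanglandsShelstad1987, §3] [cite: Rogawski1990, §4.9 Prop. 4.9.1 (a)(b) p. 55, §4.10 p. 58] -/
theorem labelledOddCount_div_relIndex_coreHanging_eq_of_deep₁ [CompleteSpace K] [Finite 𝓀[K]] {σ : K →+* K} {ϖ : K} {d t : ℕ}
    (hD : IsRamifiedQuadraticDatum σ ϖ d t) (h2 : Valued.v (2 : K) < 1)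
    {ρ : ℕ} (hρ : 1 ≤ ρ) {x ζ f : K} (hx : Valued.v x = 1) (hζ : Valued.v ζ = 1) (hσf : σ f = f) (hf : Valued.v f = 1) (h1f : Valued.v (1 + f) = 1)
    (V : GL (Fin 3) K) (hV : (V : Matrix (Fin 3) (Fin 3) K) = !![1, 0, 0; x, ϖ ^ ρ, 0; x * ζ + f * (x * ζ), ϖ ^ ρ * ζ, ϖ ^ (2 * ρ)])
    {α β : K} {N₀ n₁ n₂ n₃ : ℕ} (hE : IsElementDatum σ ϖ N₀ α β n₁ n₂ n₃) {mc : ℕ} (hℓN : d % 2 + 1 ≤ N₀) (hmN : d % 2 + 2 * d - 1 ≤ N₀)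
    (hℓmc : 2 * (d % 2) + 1 ≤ mc) (hmmc : d % 2 + 2 * d - 1 + d % 2 ≤ mc)
    {T : GL (Fin 3) K} (hT : (T : Matrix (Fin 3) (Fin 3) K) = Matrix.diagonal ![α, β, 1]) (hM0 : latt (V : Matrix (Fin 3) (Fin 3) K) ∈ normalisedStableLattices T)
    (hlev : LatticeInLevel ϖ (d % 2) (Matrix.diagonal ![α - 1, β - 1, 0]) (latt (V : Matrix (Fin 3) (Fin 3) K)))
    (hnlev : ¬ LatticeInLevel ϖ (d % 2 + 1) (Matrix.diagonal ![α - 1, β - 1, 0]) (latt (V : Matrix (Fin 3) (Fin 3) K)))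
    (hsq : LatticeInLevel ϖ mc (Matrix.diagonal ![(α - 1) * (α - 1), (β - 1) * (β - 1), 0]) (latt (V : Matrix (Fin 3) (Fin 3) K)))
    {gα gβ : K} (hσgα : σ gα = gα) (hσgβ : σ gβ = gβ) (hgα0 : gα ≠ 0)
    (hgα : Valued.v ((ϖ ^ (d % 2 + 2 * d - 1))⁻¹ * (((ϖ * σ ϖ) ^ ρ)⁻¹ * ((α - 1) - gα * ((ϖ - σ ϖ) * ((ϖ * σ ϖ) ^ ((d - d % 2) / 2))⁻¹)))) ≤ 1)
    (hgβ : Valued.v ((ϖ ^ (d % 2 + 2 * d - 1))⁻¹ * (((ϖ * σ ϖ) ^ ρ)⁻¹ * ((β - 1) - gβ * ((ϖ - σ ϖ) * ((ϖ * σ ϖ) ^ ((d - d % 2) / 2))⁻¹)))) ≤ 1)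
    (hsmall : Valued.v gβ ≤ Valued.v ϖ ^ (2 * d - 1) * Valued.v gα) (i : Fin 3) :
    (labelledOddCount σ ϖ 0 i (valueClassLabel σ ϖ (α - 1) (β - 1) (d % 2 + 2 * d - 1) d) (latt (V : Matrix (Fin 3) (Fin 3) K)) : ℚ) /
        ((((unitStabilizer (latt (V : Matrix (Fin 3) (Fin 3) K))).map (unitNormMap σ 3)).relIndex (fixedUnitTorus σ 3) : ℕ) : ℚ) =
      stabiliserWeight σ (latt (V : Matrix (Fin 3) (Fin 3) K)) / 2 *
        (((![normSign σ f * (normSign σ f * normSign σ gα),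
             normSign σ f * normSign σ gα * (if 2 * d - 1 ≤ ρ then 1 else 0),
             normSign σ (-(1 + f)) * (normSign σ f * normSign σ gα) * (if 2 * d - 1 ≤ ρ then 1 else 0)] : Fin 3 → ℤ) i : ℤ) : ℚ) := by
  classical
  have hTr := trace_bound_of_isRamifiedQuadraticDatum hD h2
  obtain ⟨hσ, hvσ, hϖ, hfix, hdd, hd1, -⟩ := id hD
  haveI := isAdicComplete_valuedInteger_of_completeSpace hϖ
  have hϖ0 : ϖ ≠ 0 := fun h => by rw [h, map_zero] at hϖ; exact (exp_ne_zero hϖ.symm).elim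
  have hϖ1 : Valued.v ϖ < 1 := by rw [hϖ, ← exp_zero, exp_lt_exp]; norm_num
  have hζ0 : ζ ≠ 0 := fun h => by rw [h, map_zero] at hζ; exact zero_ne_one hζ
  have hx0 : x ≠ 0 := fun h => by rw [h, map_zero] at hx; exact zero_ne_one hx
  have hf0 : f ≠ 0 := fun h => by rw [h, map_zero] at hf; exact zero_ne_one hf
  have h1f0 : 1 + f ≠ 0 := fun h => by rw [h, map_zero] at h1f; exact zero_ne_one h1f
  -- the unit letters of the member
  have hy''1 : Valued.v (f * (x * ζ)) = 1 := by rw [map_mul, map_mul, hf, hx, hζ, one_mul, one_mul]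
  have hy1 : Valued.v (x * ζ + f * (x * ζ)) = 1 := by
    rw [show x * ζ + f * (x * ζ) = x * ζ * (1 + f) by ring, map_mul, map_mul, hx, hζ, h1f, one_mul, one_mul]
  -- ★ κH (A1): the explicit polarisation with lineariser `f′ = f·Nζ`
  have hσf' : σ (f * (ζ * σ ζ)) = f * (ζ * σ ζ) := by rw [map_mul, map_mul, hσf, hσ, mul_comm (σ ζ) ζ]
  have hR : Valued.v (ζ * σ (f * (x * ζ)) - σ x * (f * (ζ * σ ζ))) ≤ Valued.v ϖ ^ ρ := by
    rw [show ζ * σ (f * (x * ζ)) - σ x * (f * (ζ * σ ζ)) = 0 by rw [map_mul, map_mul, hσf]; ring, map_zero]; exact zero_le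
  obtain ⟨D, ⟨hD1, hD2, hD0⟩, hDσ, hDV⟩ := exists_explicit_polarisation_latt_hnf_coreHanging hσ hvσ hϖ0 hϖ1 hTr ρ hρ hx hζ hy''1 hy1 V hV hσf' hR
  obtain ⟨hω1, hω2, hω0⟩ := normSign_polarisation_coreHanging σ hϖ0 ρ hx hζ hσf hf h1f hD1 hD2 hD0
  -- `D₀ = D₁·N(x)·f`
  have hN0 : ζ * σ ζ ≠ 0 := mul_ne_zero hζ0 ((map_ne_zero σ).2 hζ0)
  have hσϖ0 : σ ϖ ≠ 0 := (map_ne_zero σ).2 hϖ0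
  have hπ0 : ((ϖ * σ ϖ) ^ ρ : K) ≠ 0 := pow_ne_zero _ (mul_ne_zero hϖ0 hσϖ0)
  have hσζ0 : σ ζ ≠ 0 := (map_ne_zero σ).2 hζ0
  have hσx0 : σ x ≠ 0 := (map_ne_zero σ).2 hx0
  have hNf : ζ * σ ζ + f * (ζ * σ ζ) ≠ 0 := by
    rw [show ζ * σ ζ + f * (ζ * σ ζ) = ζ * σ ζ * (1 + f) by ring]; exact mul_ne_zero hN0 h1f0
  have hD0' : D 0 = D 1 * (x * σ x) * f := by
    have hy : x * ζ + f * (x * ζ) = x * ζ * (1 + f) := by ring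
    rw [hD0, hD1, hy, map_mul, map_mul, map_add, map_one, hσf]
    field_simp
    ring
  -- normalised; the type-0 fibre is one `S_F`-coset; the orbit is finite; the NI2 letters
  have hnorm : IsNormalisedLattice (latt (V : Matrix (Fin 3) (Fin 3) K)) := by rw [hV]; exact isNormalisedLattice_latt_coreHanging hϖ1.le ρ hx hζ hy1
  have hcoset : ∀ D' : Fin 3 → K, (∀ j, σ (D' j) = D' j ∧ D' j ≠ 0) →
      (IsVertexLattice σ ϖ (Matrix.diagonal D') 0 (latt (V : Matrix (Fin 3) (Fin 3) K)) ↔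
        ∃ u ∈ fixedUnitStabilizer σ (latt (V : Matrix (Fin 3) (Fin 3) K)), ∀ j, D' j = D j * ((u j : Kˣ) : K)) :=
    fun D' hD' => fibre_isCoset_zero hvσ ϖ V rfl hnorm D hDσ hDV D' hD'
  have hfin := finite_unitTorus_orbit_of_mem_normalisedStableLattices hϖ (v_diag_eq_one hvσ hE) (diag_regular hE) T hT hM0
  obtain ⟨c, hσc, hcv, hcn, hdich⟩ := exists_nonnorm_dichotomy_of_isRamifiedQuadraticDatum σ ϖ d t hD
  have hTM : mapGL T (latt (V : Matrix (Fin 3) (Fin 3) K)) = latt (V : Matrix (Fin 3) (Fin 3) K) := hM0.2.1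
  -- the sign `ε = ω(f)ω(g_α)` and the ONE-SLOT label in slot 0 (§1 + FILE 2a)
  set ε : ℤ := normSign σ f * normSign σ gα with hεdef
  have hε : ε = 1 ∨ ε = -1 := by
    rw [hεdef]; unfold normSign; split_ifs <;> simp
  have hΛ : ∀ u ∈ fixedUnitStabilizer σ (latt (V : Matrix (Fin 3) (Fin 3) K)),
      valueClassLabel σ ϖ (α - 1) (β - 1) (d % 2 + 2 * d - 1) d (latt (V : Matrix (Fin 3) (Fin 3) K)) (fun j => D j * ((u j : Kˣ) : K)) ↔
        ε * normSign σ ((u 0 : Kˣ) : K) = 1 := by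
    intro u hu
    have hufix : ∀ j, σ ((u j : Kˣ) : K) = u j := fun j => ((mem_fixedUnitTorus_iff σ u).1 hu.2).2 j
    have huv : ∀ j, Valued.v ((u j : Kˣ) : K) = 1 := fun j => ((mem_fixedUnitTorus_iff σ u).1 hu.2).1 j
    have hDu : ∀ j, σ (D j * ((u j : Kˣ) : K)) = D j * ((u j : Kˣ) : K) ∧ D j * ((u j : Kˣ) : K) ≠ 0 := fun j =>
      ⟨by rw [map_mul, (hDσ j).1, hufix j], mul_ne_zero (hDσ j).2 (u j).ne_zero⟩
    have hMu : IsVertexLattice σ ϖ (Matrix.diagonal fun j => D j * ((u j : Kˣ) : K)) 0 (latt (V : Matrix (Fin 3) (Fin 3) K)) :=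
      (hcoset _ hDu).2 ⟨u, hu, fun _ => rfl⟩
    -- the weights `D₀u₀ = π₀^{−ρ}·(N(x) f u₀)` and `D₁u₁N(x) = π₀^{−ρ}·(u₁ N(x))` are `π₀^{−ρ}` times units
    have hwt0 : Valued.v (x * σ x * f * ((u 0 : Kˣ) : K)) ≤ 1 := by rw [map_mul, map_mul, map_mul, hx, hvσ, hx, hf, huv 0]; norm_num
    have hwt1 : Valued.v (((u 1 : Kˣ) : K) * (x * σ x)) ≤ 1 := by rw [map_mul, map_mul, huv 1, hx, hvσ, hx]; norm_num
    have hgαu : Valued.v ((ϖ ^ (d % 2 + 2 * d - 1))⁻¹ *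
        (D 0 * ((u 0 : Kˣ) : K) * ((α - 1) - gα * ((ϖ - σ ϖ) * ((ϖ * σ ϖ) ^ ((d - d % 2) / 2))⁻¹)))) ≤ 1 := by
      have e : (ϖ ^ (d % 2 + 2 * d - 1))⁻¹ * (D 0 * ((u 0 : Kˣ) : K) * ((α - 1) - gα * ((ϖ - σ ϖ) * ((ϖ * σ ϖ) ^ ((d - d % 2) / 2))⁻¹))) =
          (x * σ x * f * ((u 0 : Kˣ) : K)) * ((ϖ ^ (d % 2 + 2 * d - 1))⁻¹ * (((ϖ * σ ϖ) ^ ρ)⁻¹ * ((α - 1) - gα * ((ϖ - σ ϖ) * ((ϖ * σ ϖ) ^ ((d - d % 2) / 2))⁻¹)))) := by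
        rw [hD0', hD1]; ring
      rw [e, map_mul]; exact mul_le_one' hwt0 hgα
    have hgβu : Valued.v ((ϖ ^ (d % 2 + 2 * d - 1))⁻¹ *
        (D 1 * ((u 1 : Kˣ) : K) * (x * σ x) * ((β - 1) - gβ * ((ϖ - σ ϖ) * ((ϖ * σ ϖ) ^ ((d - d % 2) / 2))⁻¹)))) ≤ 1 := by
      have e : (ϖ ^ (d % 2 + 2 * d - 1))⁻¹ * (D 1 * ((u 1 : Kˣ) : K) * (x * σ x) * ((β - 1) - gβ * ((ϖ - σ ϖ) * ((ϖ * σ ϖ) ^ ((d - d % 2) / 2))⁻¹))) =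
          (((u 1 : Kˣ) : K) * (x * σ x)) * ((ϖ ^ (d % 2 + 2 * d - 1))⁻¹ * (((ϖ * σ ϖ) ^ ρ)⁻¹ * ((β - 1) - gβ * ((ϖ - σ ϖ) * ((ϖ * σ ϖ) ^ ((d - d % 2) / 2))⁻¹)))) := by
        rw [hD1]; ring
      rw [e, map_mul]; exact mul_le_one' hwt1 hgβ
    have hread := valueClassLabel_latt_coreHanging_iff_normSign_linear hD hρ hx hζ hy1 V hV (D := fun j => D j * ((u j : Kˣ) : K))
      (fun j => (hDu j).1) (fun j => (hDu j).2) hMu hE hℓN hmN hℓmc hmmc hlev hnlev hsq hT hTM hσgα hσgβ hgαu hgβu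
    rw [hread]
    -- `D₀u₀·g_α + D₁u₁·N(x)·g_β = (D₁·N(x)) · (u₀ f g_α + u₁ g_β)`, and `ω(D₁·N(x)) = 1`
    have hfac : D 0 * ((u 0 : Kˣ) : K) * gα + D 1 * ((u 1 : Kˣ) : K) * (x * σ x) * gβ =
        (D 1 * (x * σ x)) * (((u 0 : Kˣ) : K) * f * gα + ((u 1 : Kˣ) : K) * gβ) := by rw [hD0']; ring
    have hσD1x : σ (D 1 * (x * σ x)) = D 1 * (x * σ x) := by rw [map_mul, (hDσ 1).1, map_mul, hσ, mul_comm (σ x) x]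
    have hD1x0 : D 1 * (x * σ x) ≠ 0 := mul_ne_zero (hDσ 1).2 (mul_ne_zero hx0 ((map_ne_zero σ).2 hx0))
    have hωD1x : normSign σ (D 1 * (x * σ x)) = 1 := by
      rw [normSign_mul_of_fixed hD (hDσ 1).1 (by rw [map_mul, hσ, mul_comm]) (hDσ 1).2 (mul_ne_zero hx0 ((map_ne_zero σ).2 hx0)), hω1, one_mul]
      exact normSign_of_isNorm σ ⟨x, rfl⟩
    have hS0 : σ (((u 0 : Kˣ) : K) * f * gα + ((u 1 : Kˣ) : K) * gβ) = ((u 0 : Kˣ) : K) * f * gα + ((u 1 : Kˣ) : K) * gβ := by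
      rw [map_add, map_mul, map_mul, map_mul, hufix 0, hσf, hσgα, hufix 1, hσgβ]
    by_cases hZ0 : ((u 0 : Kˣ) : K) * f * gα + ((u 1 : Kˣ) : K) * gβ = 0
    · -- impossible: `u₀ f g_α = −u₁ g_β` has valuation `≤ |ϖ|^{2d−1}|g_α| < |g_α| = |u₀ f g_α|`
      exfalso
      have hvgα : 0 < Valued.v gα := (Valuation.pos_iff _).2 hgα0
      have hid : ((u 0 : Kˣ) : K) * f * gα = -(((u 1 : Kˣ) : K) * gβ) := by linear_combination hZ0
      have h1 : Valued.v gα ≤ Valued.v ϖ ^ (2 * d - 1) * Valued.v gα := by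
        have h := congrArg Valued.v hid
        rw [map_mul, map_mul, huv 0, hf, one_mul, one_mul, Valuation.map_neg, map_mul, huv 1, one_mul] at h
        calc Valued.v gα = Valued.v gβ := h
          _ ≤ Valued.v ϖ ^ (2 * d - 1) * Valued.v gα := hsmall
      have hlt : Valued.v ϖ ^ (2 * d - 1) < 1 := pow_lt_one₀ zero_le hϖ1 (by omega)
      have : Valued.v gα < Valued.v gα := by
        calc Valued.v gα ≤ Valued.v ϖ ^ (2 * d - 1) * Valued.v gα := h1
          _ < 1 * Valued.v gα := mul_lt_mul_of_pos_right hlt hvgα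
          _ = Valued.v gα := one_mul _
      exact lt_irrefl _ this
    · rw [hfac, normSign_mul_of_fixed hD hσD1x hS0 hD1x0 hZ0, hωD1x, one_mul,
        normSign_twoSlot_eq_of_deep₁ hD hσf hf hσgα hσgβ hgα0 hsmall hu, hεdef]
  -- ★ ONE-SLOT head at `k = 0`
  have hhead := labelledOddCount_div_relIndex_eq_of_oneSlot hσ hvσ hσc hcv hcn hdich hfin hDσ hDV hcoset
    (valueClassLabel σ ϖ (α - 1) (β - 1) (d % 2 + 2 * d - 1) d) i 0 hε hΛ
  rw [hhead]
  -- the ω-table of `D` and the alive ∕ dead window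
  have hV0 : (V : Matrix (Fin 3) (Fin 3) K) = !![1, 0, 0; x, ϖ ^ ρ, 0; x * ζ + f * (x * ζ), ϖ ^ ρ * ζ, ϖ ^ (2 * ρ + 0)] := by rw [Nat.add_zero]; exact hV
  have hωD : ∀ j : Fin 3, normSign σ (D j) = (![normSign σ f, 1, normSign σ (-(1 + f))] : Fin 3 → ℤ) j := fun j => by
    fin_cases j
    · exact hω0
    · exact hω1
    · exact hω2
  -- the pair indicator `[ω(u_i)ω(u_0) ≡ 1 on S_F]`
  have hind : (if ∀ u ∈ fixedUnitStabilizer σ (latt (V : Matrix (Fin 3) (Fin 3) K)), normSign σ ((u i : Kˣ) : K) * normSign σ ((u 0 : Kˣ) : K) = 1 then (1 : ℤ) else 0) =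
      (![1, (if 2 * d - 1 ≤ ρ then 1 else 0), (if 2 * d - 1 ≤ ρ then 1 else 0)] : Fin 3 → ℤ) i := by
    fin_cases i
    · -- pair (0,0): always
      show (if ∀ u ∈ fixedUnitStabilizer σ (latt (V : Matrix (Fin 3) (Fin 3) K)), normSign σ ((u 0 : Kˣ) : K) * normSign σ ((u 0 : Kˣ) : K) = 1 then (1 : ℤ) else 0) = 1
      rw [if_pos (fun u _ => normSign_mul_self σ _)]
    · -- pair (1,0) = `chiVec 2`
      show (if ∀ u ∈ fixedUnitStabilizer σ (latt (V : Matrix (Fin 3) (Fin 3) K)), normSign σ ((u 1 : Kˣ) : K) * normSign σ ((u 0 : Kˣ) : K) = 1 then (1 : ℤ) else 0) =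
        (if 2 * d - 1 ≤ ρ then 1 else 0)
      by_cases hal : 2 * d - 1 ≤ ρ
      · rw [if_pos hal, if_pos]
        intro u hu
        have h := chiVec_eq_one_of_mem_fixedUnitStabilizer_of_le hD ρ hx hζ hf V hV0 hal hu 2
        rw [chiVec_apply] at h
        have h' : normSign σ ((u 0 : Kˣ) : K) * normSign σ ((u 1 : Kˣ) : K) = 1 := by simpa using h
        rw [mul_comm]; exact h'
      · rw [if_neg hal, if_neg]
        obtain ⟨u, hu, hne⟩ := exists_mem_fixedUnitStabilizer_chiVec_ne_one_of_lt hD h2 ρ hx hζ hσf hf h1f V hV0 (by omega) 2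
        rw [chiVec_apply] at hne
        exact fun h => hne (by have h' := h u hu; rw [mul_comm] at h'; simpa using h')
    · -- pair (2,0) = `chiVec 1`
      show (if ∀ u ∈ fixedUnitStabilizer σ (latt (V : Matrix (Fin 3) (Fin 3) K)), normSign σ ((u 2 : Kˣ) : K) * normSign σ ((u 0 : Kˣ) : K) = 1 then (1 : ℤ) else 0) =
        (if 2 * d - 1 ≤ ρ then 1 else 0)
      by_cases hal : 2 * d - 1 ≤ ρ
      · rw [if_pos hal, if_pos]
        intro u hu
        have h := chiVec_eq_one_of_mem_fixedUnitStabilizer_of_le hD ρ hx hζ hf V hV0 hal hu 1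
        rw [chiVec_apply] at h
        have h' : normSign σ ((u 0 : Kˣ) : K) * normSign σ ((u 2 : Kˣ) : K) = 1 := by simpa using h
        rw [mul_comm]; exact h'
      · rw [if_neg hal, if_neg]
        obtain ⟨u, hu, hne⟩ := exists_mem_fixedUnitStabilizer_chiVec_ne_one_of_lt hD h2 ρ hx hζ hσf hf h1f V hV0 (by omega) 1
        rw [chiVec_apply] at hne
        exact fun h => hne (by have h' := h u hu; rw [mul_comm] at h'; simpa using h')
  rw [hind, hωD]
  fin_cases i <;> simp <;> ring

end Summit.HodgeConjecture.HodgeConjecture.Cruxes.H413.F0P3cDyRamLabelledOddCoreHangingDeepReadOne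

end
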